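import Literature.AlgebraicGeometry.Resolution.WeightedCentreTowerStep
import Literature.AlgebraicGeometry.Resolution.MvPolynomialKillVars
import HarnessLib

/-!
# Weighted centres — the HONEST face ring `S ⧸ (ε_Z) ≃+* k[ε_{¬Z}][σ]` and the tower storey `ρ₁` landing in its automorphism group

Instrument for engine 1's `W(f)` TOY MODEL (cell `pub-rosobs`, LF-MODEL-eng1-g45 §6.2 REDUCTION: "the target of `ρ₁` is the isotropy group of the face"; typing plan of
CARVER-NOTES-eng1-g47 §2 (a)–(b), whose kernel-checked scratch probe `FaceRingEquivProbe.lean` is lifted here), NOT a resolution theorem and NOT about the invariant of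
[AbramovichTemkinWlodarczyk2024].

* `faceRingEquiv Z : S ⧸ slotIdeal Z ≃+* (MvPolynomial {j // j ∉ Z} k)[X]` (`S = k[ε][σ]`; Mathlib's `Ideal.polynomialQuotientEquivQuotientPolynomial` composed with the tree's
  `MvPolynomial.quotientSpanXEquiv`), with the evaluation rules `faceRingEquiv_mk_C` (`C P ↦ C (killCompl P)`) and `faceRingEquiv_mk_X` (`σ ↦ σ`);
* `autConj e` — transport of ring automorphisms along a ring isomorphism (a group homomorphism, injective);
* `restrictFace w Z V g := autConj (faceRingEquiv Z) ∘ restrictZ w Z V g : isoFix w Z V g →* Aut (k[ε_{¬Z}][σ])`, its evaluation rule and (THEOREM B) its injectivity.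

References: [Lang2002, Ch. I §3, Ch. II §1, Ch. IV §1]; [Matsumura1987, §27]; [AbramovichTemkinWlodarczyk2024, §5.1 (p. 1575)].
-/

namespace Literature.AlgebraicGeometry.Resolution.WeightedBlowup.ZKernel

open Polynomial

section Conj

variable {A B : Type*} [Mul A] [Add A] [Mul B] [Add B]

/-- **Transport of automorphisms along a ring isomorphism** `e : A ≃+* B`: `f ↦ e ∘ f ∘ e⁻¹`, a group homomorphism `(A ≃+* A) →* (B ≃+* B)` (bookkeeping).
[cite: Lang2002, Ch. I §3] -/
def autConj (e : A ≃+* B) : (A ≃+* A) →* (B ≃+* B) where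
  toFun f := (e.symm.trans f).trans e
  map_one' := by
    ext x
    show e (e.symm x) = x
    exact e.apply_symm_apply x
  map_mul' f g := by
    ext x
    show e ((f * g) (e.symm x)) = e (f (e.symm (e (g (e.symm x)))))
    rw [RingAut.mul_apply, e.symm_apply_apply]

/-- `autConj e f x = e (f (e⁻¹ x))` (bookkeeping). [cite: Lang2002, Ch. I §3] -/
theorem autConj_apply (e : A ≃+* B) (f : A ≃+* A) (x : B) : autConj e f x = e (f (e.symm x)) := rfl

/-- `autConj e` is injective (bookkeeping). [cite: Lang2002, Ch. I §3] -/
theorem autConj_injective (e : A ≃+* B) : Function.Injective (autConj e) := fun f g h => by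
  ext a
  have h' := RingEquiv.congr_fun h (e a)
  rw [autConj_apply, autConj_apply, e.symm_apply_apply] at h'
  exact e.injective h'

end Conj

variable {k : Type*} [CommRing k] {ι : Type*}

/-- **The honest face ring**: `S ⧸ (ε_Z) ≃+* k[ε_{¬Z}][σ]` (CARVER-NOTES-eng1-g47 §2 (a); Mathlib `Ideal.polynomialQuotientEquivQuotientPolynomial` + the tree's
`MvPolynomial.quotientSpanXEquiv`; bookkeeping). [cite: Lang2002, Ch. II §1, Ch. IV §1] -/
noncomputable def faceRingEquiv (Z : Set ι) :
    ((MvPolynomial ι k)[X] ⧸ slotIdeal (k := k) Z) ≃+* (MvPolynomial {j : ι // j ∉ Z} k)[X] :=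
  (Ideal.polynomialQuotientEquivQuotientPolynomial (Ideal.span (MvPolynomial.X '' Z) : Ideal (MvPolynomial ι k))).symm.trans
    (Polynomial.mapEquiv (Literature.AlgebraicGeometry.Resolution.MvPolynomial.quotientSpanXEquiv (R := k) Z).toRingEquiv)

/-- Evaluation rule on the class of `C P` (`P ∈ k[ε]`): kill the `Z`-variables (bookkeeping). [cite: Lang2002, Ch. II §1] -/
theorem faceRingEquiv_mk_C (Z : Set ι) (P : MvPolynomial ι k) :
    faceRingEquiv Z (Ideal.Quotient.mk (slotIdeal (k := k) Z) (C P)) =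
      C (_root_.MvPolynomial.killCompl (Subtype.val_injective (p := fun j : ι => j ∉ Z)) P) := by
  change Polynomial.mapEquiv _ ((Ideal.polynomialQuotientEquivQuotientPolynomial
    (Ideal.span (MvPolynomial.X '' Z) : Ideal (MvPolynomial ι k))).symm (Ideal.Quotient.mk _ (C P))) = _
  rw [Ideal.polynomialQuotientEquivQuotientPolynomial_symm_mk, Polynomial.map_C, Polynomial.mapEquiv_apply, Polynomial.map_C]
  rfl

/-- Evaluation rule on the class of `σ` (bookkeeping). [cite: Lang2002, Ch. II §1] -/
theorem faceRingEquiv_mk_X (Z : Set ι) : faceRingEquiv Z (Ideal.Quotient.mk (slotIdeal (k := k) Z) X) = X := by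
  change Polynomial.mapEquiv _ ((Ideal.polynomialQuotientEquivQuotientPolynomial
    (Ideal.span (MvPolynomial.X '' Z) : Ideal (MvPolynomial ι k))).symm (Ideal.Quotient.mk _ X)) = _
  rw [Ideal.polynomialQuotientEquivQuotientPolynomial_symm_mk, Polynomial.map_X, Polynomial.mapEquiv_apply, Polynomial.map_X]

/-- **The tower storey landing in the automorphism group of the honest face ring**: `ρ₁^Z := autConj (faceRingEquiv Z) ∘ restrictZ` (LF-MODEL-eng1-g45 §6.2 REDUCTION;
CARVER-NOTES-eng1-g47 §2 (b); bookkeeping). [cite: Lang2002, Ch. I §3, Ch. II §1] -/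
noncomputable def restrictFace (w : ι → ℚ) (Z V : Set ι) (g : MvPolynomial ι k) :
    isoFix w Z V g →* ((MvPolynomial {j : ι // j ∉ Z} k)[X] ≃+* (MvPolynomial {j : ι // j ∉ Z} k)[X]) :=
  (autConj (faceRingEquiv Z)).comp (restrictZ w Z V g)

/-- Evaluation rule: `ρ₁^Z A` acts on the image of a class as the class of the image (bookkeeping). [cite: Lang2002, Ch. II §1] -/
theorem restrictFace_apply {w : ι → ℚ} {Z V : Set ι} {g : MvPolynomial ι k} (A : isoFix w Z V g) (y : (MvPolynomial ι k)[X]) :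
    restrictFace w Z V g A (faceRingEquiv Z (Ideal.Quotient.mk (slotIdeal Z) y)) =
      faceRingEquiv Z (Ideal.Quotient.mk (slotIdeal Z) ((A : (MvPolynomial ι k)[X] ≃+* (MvPolynomial ι k)[X]) y)) := by
  rw [restrictFace, MonoidHom.comp_apply, autConj_apply, RingEquiv.symm_apply_apply, restrictZ_mk]

/-- `ρ₁^Z A` fixes `σ` (bookkeeping: `A` fixes `σ`). [cite: Lang2002, Ch. II §1] -/
theorem restrictFace_X {w : ι → ℚ} {Z V : Set ι} {g : MvPolynomial ι k} (A : isoFix w Z V g) : restrictFace w Z V g A X = X := by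
  rw [← faceRingEquiv_mk_X Z, restrictFace_apply, A.2.1.1.1.1.2.1]

/-- `ρ₁^Z A` on a slot class: `ε_j ↦` the face image of `A (C ε_j)` (bookkeeping). [cite: Lang2002, Ch. II §1] -/
theorem restrictFace_C_X {w : ι → ℚ} {Z V : Set ι} {g : MvPolynomial ι k} (A : isoFix w Z V g) (j : {j : ι // j ∉ Z}) :
    restrictFace w Z V g A (C (MvPolynomial.X j)) =
      faceRingEquiv Z (Ideal.Quotient.mk (slotIdeal Z) ((A : (MvPolynomial ι k)[X] ≃+* (MvPolynomial ι k)[X]) (C (MvPolynomial.X j.1)))) := by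
  rw [← restrictFace_apply, faceRingEquiv_mk_C, Literature.AlgebraicGeometry.Resolution.MvPolynomial.killCompl_X_apply]

section Injective

variable {w : ι → ℚ} {Z : Set ι} {ζ : ℚ} (p : ℕ) [Fact p.Prime] [CharP k p] {u : ℕ → k} {g : MvPolynomial ι k}

/-- **`ρ₁^Z` is injective** (THEOREM B, via `restrictZ_injective`; LF-MODEL-eng1-g45 §6.2 REDUCTION, one storey on the honest face ring).  Instrument for engine 1's `W(f)` toy model,
NOT a resolution theorem. [cite: Lang2002, Ch. I §3, Ch. II §1, Ch. IV §1; Matsumura1987, §27 (pp. 207–209); AbramovichTemkinWlodarczyk2024, §5.1 (p. 1575)] -/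
theorem restrictFace_injective (hu : ∀ n < p, (Nat.factorial n : k) * u n = 1) (hw : ∀ i, 0 ≤ w i) (hZ : ∀ z ∈ Z, ζ ≤ w z) (hζ : 0 < ζ)
    (hZp : ∀ z ∈ Z, w z < p) {V : Set ι} (hVw : ∀ i, w i ≤ (p : ℚ) + 1 ∨ i ∈ V) (hwV : ∀ i ∈ V, (p : ℚ) + 1 < w i)
    (hN : TailedLightFlow.NoTailedLightFlow p u w g) : Function.Injective (restrictFace w Z V g) :=
  (autConj_injective _).comp (restrictZ_injective p hu hw hZ hζ hZp hVw hwV hN)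

end Injective

end Literature.AlgebraicGeometry.Resolution.WeightedBlowup.ZKernel
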